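import Mathlib
import Summits.Ventures.PercRepro2.OneTypedEdge
import Summits.Ventures.PercRepro2.TypedSpectator
import Summits.Ventures.PercRepro2.TypedUntouched

/-!
# Marked series vertices of degree two: the signature model (blind cell PercRepro2, night-3 g13,
2026-08-27; `proofs/NIGHT3-CERT.md` §22)

A mark `w` of degree two whose two edges `e = {u, w}`, `f = {w, v}` lead to two OTHER marks is a
«marked series vertex».  Unlike the unmarked series rule (`TypedSeries.lean`, rule (a)) there is no
reduction to one merged edge, because the state coordinates of `w` itself differ from those of the
contracted vertex.  Instead, in the configuration with both edges closed `w` is isolated, and the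
whole state of a copy is an explicit Boolean function (`modelA`, `modelC`, `modelD`) of

* the **signature**: the six connections among the other four marks, and
* the two bits `p = [e open]`, `a = [f open]` — the merged edge `u–v` is open iff `p && a`.

This file holds the models, the consistency test of a signature (`consB`; every configuration's
signature is consistent: `consB_sig`, transitivity), and the nine-term colouring sum `S9` whose
vanishing on every consistent signature triple is the kernel content of the four marked-series
vanishing rules (`TypedMarkedSeriesIdA/C/D.lean`, `decide`).  The graph lemmas are in
`TypedMarkedSeriesGraph.lean`, the state lemmas in `TypedMarkedSeriesState*.lean`, the theorems in
`TypedMarkedSeries.lean`.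
-/

namespace Summit.Ventures.PercRepro2

open UnionCluster

namespace CovForm

namespace MarkedSeries

open OneTyped TypedA3 Untouched

/-! ## Signatures and the three models -/

section Models

/-- Consistency of six connection bits `c12 c1b c13 c2b c23 cb3` among four points `1, 2, b, 3`
(transitivity through each third point), as a Boolean test. -/
def consB (c12 c1b c13 c2b c23 cb3 : Bool) : Bool :=
  (!c12 || !c1b || c2b) && (!c12 || !c13 || c23) && (!c12 || !c2b || c1b) && (!c12 || !c23 || c13) &&
  (!c1b || !c13 || cb3) && (!c1b || !cb3 || c13) && (!c13 || !cb3 || c1b) && (!c2b || !c23 || cb3) &&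
  (!c2b || !cb3 || c23) && (!c23 || !cb3 || c2b) && (!c1b || !c2b || c12) && (!c13 || !c23 || c12)

/-- **Model A** (`o` between `a₁` and `a₃`): the state of a copy when `o` carries exactly the edges
`e = {a₁, o}` (open iff `p`) and `f = {o, a₃}` (open iff `a`), from the signature
`(c12, c1b, c13, c2b, c23, cb3)` of the configuration with both closed. -/
def modelA (c12 c1b c13 c2b c23 cb3 : Bool) (p a : Bool) : St :=
  (c12 || (p && a && c23), p || (a && (c13 || (p && a))),
    (p && (c12 || (p && a && c23))) || (a && (c23 || (p && a && c12))), c1b || (p && a && cb3),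
    c2b || (p && a && (c12 || c23) && (c1b || cb3)), c13 || (p && a), c23 || (p && a && c12))

/-- **Model C** (`o` between the two roots): `e = {a₁, o}` (bit `p`), `f = {o, a₂}` (bit `a`). -/
def modelC (c12 c1b c13 c2b c23 _cb3 : Bool) (p a : Bool) : St :=
  (c12 || (p && a), p || (a && (c12 || (p && a))), a || (p && (c12 || (p && a))),
    c1b || (p && a && c2b), c2b || (p && a && c1b), c13 || (p && a && c23), c23 || (p && a && c13))

/-- **Model D** (`b` between the two roots): `e = {a₁, b}` (bit `p`), `f = {b, a₂}` (bit `a`); the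
signature is now `(c12, c1o, c13, c2o, c23, co3)` over the marks `a₁, a₂, o, a₃`. -/
def modelD (c12 c1o c13 c2o c23 _co3 : Bool) (p a : Bool) : St :=
  (c12 || (p && a), c1o || (p && a && c2o), c2o || (p && a && c1o),
    p || (a && (c12 || (p && a))), a || (p && (c12 || (p && a))),
    c13 || (p && a && c23), c23 || (p && a && c13))

/-- The colourings of a typed edge of type `k` (which copies carry it). -/
def cols : ℕ → List (Bool × Bool × Bool)
  | 1 => [(true, false, false), (false, true, false), (false, false, true)]
  | 2 => [(true, true, false), (true, false, true), (false, true, true)]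
  | _ => []

/-- The nine-term sum of the symmetrised kernel over the colourings of the two edges
(`e` of type `k`, `f` of type `l`), each copy's state given by its model. -/
def S9 (k l : ℕ) (m₁ m₂ m₃ : Bool → Bool → St) : ℤ :=
  ((cols l).map fun abc => ((cols k).map fun pqr =>
    KBsym (m₁ pqr.1 abc.1) (m₂ pqr.2.1 abc.2.1) (m₃ pqr.2.2 abc.2.2)).sum).sum

end Models

/-! ## Consistency of a signature -/

section Sig

open Classical

variable {V : Type*} {E : Type*}

/-- A Boolean implication clause from a propositional one. -/
lemma imp3 {P Q R : Prop} [Decidable P] [Decidable Q] [Decidable R] (h : P → Q → R) :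
    (!decide P || !decide Q || decide R) = true := by
  by_cases hp : P <;> by_cases hq : Q <;> simp_all

/-- The six connection bits of any configuration form a consistent signature. -/
lemma consB_sig (ends : E → Sym2 V) (ω : Config E) (a₁ a₂ b a₃ : V) :
    consB (decide (Conn ends ω a₁ a₂)) (decide (Conn ends ω a₁ b)) (decide (Conn ends ω a₁ a₃))
      (decide (Conn ends ω a₂ b)) (decide (Conn ends ω a₂ a₃)) (decide (Conn ends ω b a₃)) = true := by
  unfold consB
  simp only [Bool.and_eq_true]
  refine ⟨⟨⟨⟨⟨⟨⟨⟨⟨⟨⟨?_, ?_⟩, ?_⟩, ?_⟩, ?_⟩, ?_⟩, ?_⟩, ?_⟩, ?_⟩, ?_⟩, ?_⟩, ?_⟩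
  · exact imp3 fun h1 h2 => conn_trans (conn_symm h1) h2
  · exact imp3 fun h1 h2 => conn_trans (conn_symm h1) h2
  · exact imp3 fun h1 h2 => conn_trans h1 h2
  · exact imp3 fun h1 h2 => conn_trans h1 h2
  · exact imp3 fun h1 h2 => conn_trans (conn_symm h1) h2
  · exact imp3 fun h1 h2 => conn_trans h1 h2
  · exact imp3 fun h1 h2 => conn_trans h1 (conn_symm h2)
  · exact imp3 fun h1 h2 => conn_trans (conn_symm h1) h2
  · exact imp3 fun h1 h2 => conn_trans h1 h2
  · exact imp3 fun h1 h2 => conn_trans h1 (conn_symm h2)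
  · exact imp3 fun h1 h2 => conn_trans h1 (conn_symm h2)
  · exact imp3 fun h1 h2 => conn_trans h1 (conn_symm h2)

end Sig

end MarkedSeries

end CovForm

end Summit.Ventures.PercRepro2
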